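import Summits.QuantumFields.BalabanUV.T4Continuum.Support.NE7PairwiseMarginal

/-!
# NE7PairwiseMarginalBox — row NE7 (node U5), route «PAIR-CAUCHY»: the rate-free MARGINAL lemma in its BOX form (M♭′) —
# NO uniform bound on the accumulated sources is assumed; the deep-memory tail is controlled by the printed COUPLING BOX
# (`|g^A − g^B| ≤ γ̄`) and the a-priori bound on the discrepancy is SCALE-WISE AFFINE (from `BetaUpperH`), not uniform

Cell `pub-balaban`, rung (B)+1 sub-cell t4, lineage `b2b-balaban-t4-ne7-p2` (CRUX PROVER NE7 #2 under the coordinator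
ruling «YM redirect», 2026-08-21; generation 48; route text `HOME/t4/b2b-balaban-t4-ne7-p2/g48/ROUTE2-NE7-P2.md` §2 (M♭),
ERRATUM E-g48-1).  Companion ∕ CORRECTION of `Support/NE7PairwiseMarginal` (p248053).  HONEST FRAMING (page 1): FIXED
FINITE T⁴, rung (B)+1, CONDITIONAL on BetaPertH and the nine spine estimates (0/9 proved); NOT infinite volume, NOT a mass
gap, NOT the Clay problem.  NE7 is NOT PRINTED in [Balaban1984PropagatorsI]–[Balaban1989LargeFieldII] and NOT proved here.
[folklore] real analysis on hypothesis shapes; no definition, no cite tag, nothing printed asserted, no `sorry`.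

WHY (erratum E-g48-1 to ROUTE2 v1–v1.2 and to `NE7PairwiseMarginal`'s docstring).  `NE7PairwiseMarginal.marginal_tendsto_zero`
is correct as stated but assumes the source term `s K m` of its hypothesis (H) BOUNDED uniformly in `K` and `m`.  In the
intended instantiation `s K m` is the ACCUMULATED scale-shift source `Σ_{m′ ≤ m} σ(K − m′)` of the `m` β-increments between
the unit scale and block scale `m` (transport factor 1): it tends to `0` at fixed `m` for a NULL modulus `σ`, but it is
bounded uniformly in `m ≤ K` only if `σ` is SUMMABLE — which is exactly what the route «PAIR-CAUCHY» does not want to ask.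
(Physically: two runs pinned at the unit scale may have bare couplings differing by `Σ_{j<K} σ(j)`, unbounded for a
non-summable `σ`; harmless, because young-scale couplings enter an old-scale β-function only through the FADING MEMORY
and are anyway confined to the printed box.)  This file removes the assumption: (i) the memory tail is bounded through the
COUPLING BOX — the coupling gap `f K j` fed back obeys `f K j ≤ γ̄` ALWAYS (both runs in `]0, γ]`, [Balaban1987RG1] Thm 1
p. 259 «contained in an interval ]0, γ]») besides `f K j ≤ u K j · d K j` (the `x → g` conversion weight `u = (g^A)²g^B`,
tree `T4CouplingMatching.abs_sub_le_of_inv_sq`, with `Σ_j u K j ≤ U` the AF-window of `T4CouplingMatching` §4); (ii) the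
a-priori bound on `d` is SCALE-WISE AFFINE, `d K m ≤ B₀ + B₁·m` (from the printed-type UPPER bound `BetaUpperH`:
`1∕g_{K−m}² ≤ 1∕g² + β′·m` for runs pinned at `g`), not uniform; (iii) the sources are only `≥ 0` and NULL at each fixed
scale.  Conclusion unchanged: `d K m → 0` for every `m`.

THE HYPOTHESIS (H′), displayed once: for all `K` and all `m ≤ K`,
  `d K m ≤ s K m + C · Σ_{m′ ≤ m} Σ_{a ≤ K − m′} θ^a · f K (m′ + a)`,
with `0 ≤ f K j ≤ γ̄`, `f K j ≤ u K j · d K j`, `0 ≤ u`, `Σ_{j ≤ K} u K j ≤ U`, `0 ≤ θ < 1`, `C·U∕(1−θ) ≤ q < 1`.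

WHAT IS PROVED ([folklore]).
§1 `feedback_le_split` — the double feedback sum split at memory depth `N`: scales `< m + N` through `u·d ≤ u·X`
   (`X` a bound on `d` there), deeper scales through the box `γ̄`: `≤ U·X∕(1−θ)·… ` precisely
   `Σ_{m′≤m} Σ_{a ≤ K−m′} θ^a f K (m′+a) ≤ (U∕(1−θ))·X + (m+1)·γ̄·θ^N∕(1−θ)`.
§2 (`NE7PairwiseMarginal.sources_eventually_small` reused) `marginalBox_step` (one turn of the screw), `marginalBox_iterate` (after `p` turns:
   `d K m ≤ q^p·(B₀ + B₁(M + pN)) + tail(N, M, p) + ε` beyond some `K₀`, for `m ≤ M`), and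
   **`marginalBox_tendsto_zero : ∀ m, Tendsto (fun K => d K m) atTop (𝓝 0)`**.

NOT DELIVERED: the instance (row NE4's objects read in the x-coordinate; the docking to `T4CouplingMatching.disc_step`'s
indexing `j = K − m` is the next file).  NOT NE7 (spine 0/9 unchanged), NOT summit progress.  HONEST DEPENDENCY: continuum
YM on T⁴ ⇐ BetaPertH ∧ nine spine estimates (0/9 proved); BetaPertH ⇐ (D1) ∧ (D4) ∧ CAP+tail; G-an2-4 gates asym, D1 and
NE2/3/4.
-/

noncomputable section

open Finset Filter Topology
open scoped BigOperators

namespace Summit.QuantumFields.BalabanUV.T4Continuum.NE7PairwiseMarginalBox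

variable {θ C U q γbar B₀ B₁ : ℝ} {u f s d : ℕ → ℕ → ℝ}

/-! ## §1 The feedback split at memory depth `N` -/

/-- Geometric partial sums: `Σ_{a<R} θ^a ≤ 1∕(1−θ)` and `Σ_{a<R} θ^{N+a} ≤ θ^N∕(1−θ)`. [folklore] -/
theorem geom_partial_le (hθ0 : 0 ≤ θ) (hθ1 : θ < 1) (N R : ℕ) :
    ∑ a ∈ range R, θ ^ (N + a) ≤ θ ^ N / (1 - θ) := by
  have hs := summable_geometric_of_lt_one hθ0 hθ1
  have h1 : ∑ a ∈ range R, θ ^ a ≤ (1 - θ)⁻¹ := by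
    rw [← tsum_geometric_of_lt_one hθ0 hθ1]
    exact hs.sum_le_tsum _ fun i _ => pow_nonneg hθ0 i
  calc ∑ a ∈ range R, θ ^ (N + a) = θ ^ N * ∑ a ∈ range R, θ ^ a := by
        rw [mul_sum]; exact sum_congr rfl fun a _ => by ring
    _ ≤ θ ^ N * (1 - θ)⁻¹ := mul_le_mul_of_nonneg_left h1 (pow_nonneg hθ0 N)
    _ = θ ^ N / (1 - θ) := by rw [div_eq_mul_inv]

/-- **THE INNER MEMORY SUM SPLIT AT DEPTH `N`.**  For a fixed outer scale `m′`: the part `a < N` is bounded through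
`f ≤ u·d ≤ u·X` (all scales `m′ + a < m′ + N ≤ M + N` carry the bound `X ≥ 0` on `d`), the part `a ≥ N` through the box
`f ≤ γ̄`:  `Σ_{a ≤ K−m′} θ^a f K (m′+a) ≤ X·Σ_{a<N, a ≤ K−m′} θ^a u K (m′+a) + γ̄·θ^N∕(1−θ)`. [folklore] -/
theorem inner_le_split (hθ0 : 0 ≤ θ) (hθ1 : θ < 1) (hγ : 0 ≤ γbar) {K M N m' : ℕ} {X : ℝ}
    (hm' : m' ≤ M) (hfγ : ∀ K j, f K j ≤ γbar) (hfu : ∀ K j, f K j ≤ u K j * d K j)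
    (hu0 : ∀ K j, 0 ≤ u K j) (hX : ∀ j, j ≤ M + N → d K j ≤ X) :
    ∑ a ∈ range (K - m' + 1), θ ^ a * f K (m' + a)
      ≤ X * ∑ a ∈ range (min N (K - m' + 1)), θ ^ a * u K (m' + a) + γbar * (θ ^ N / (1 - θ)) := by
  have h1θ : 0 < 1 - θ := by linarith
  set R := K - m' + 1 with hR
  by_cases hN : N ≤ R
  · rw [min_eq_left hN, ← sum_range_add_sum_Ico _ hN]
    have hfirst : ∑ a ∈ range N, θ ^ a * f K (m' + a) ≤ X * ∑ a ∈ range N, θ ^ a * u K (m' + a) := by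
      rw [mul_sum]
      refine sum_le_sum fun a ha => ?_
      have ha' := mem_range.1 ha
      have hd : d K (m' + a) ≤ X := hX _ (by omega)
      calc θ ^ a * f K (m' + a) ≤ θ ^ a * (u K (m' + a) * d K (m' + a)) :=
            mul_le_mul_of_nonneg_left (hfu K _) (pow_nonneg hθ0 a)
        _ ≤ θ ^ a * (u K (m' + a) * X) :=
            mul_le_mul_of_nonneg_left (mul_le_mul_of_nonneg_left hd (hu0 K _)) (pow_nonneg hθ0 a)
        _ = X * (θ ^ a * u K (m' + a)) := by ring
    have hsecond : ∑ a ∈ Ico N R, θ ^ a * f K (m' + a) ≤ γbar * (θ ^ N / (1 - θ)) := by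
      rw [sum_Ico_eq_sum_range]
      calc ∑ k ∈ range (R - N), θ ^ (N + k) * f K (m' + (N + k))
          ≤ ∑ k ∈ range (R - N), θ ^ (N + k) * γbar :=
            sum_le_sum fun k _ => mul_le_mul_of_nonneg_left (hfγ K _) (pow_nonneg hθ0 _)
        _ = (∑ k ∈ range (R - N), θ ^ (N + k)) * γbar := by rw [sum_mul]
        _ ≤ θ ^ N / (1 - θ) * γbar := mul_le_mul_of_nonneg_right (geom_partial_le hθ0 hθ1 N _) hγ
        _ = γbar * (θ ^ N / (1 - θ)) := by ring
    linarith
  · rw [not_le] at hN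
    rw [min_eq_right hN.le]
    have hfirst : ∑ a ∈ range R, θ ^ a * f K (m' + a) ≤ X * ∑ a ∈ range R, θ ^ a * u K (m' + a) := by
      rw [mul_sum]
      refine sum_le_sum fun a ha => ?_
      have ha' := mem_range.1 ha
      have hd : d K (m' + a) ≤ X := hX _ (by omega)
      calc θ ^ a * f K (m' + a) ≤ θ ^ a * (u K (m' + a) * d K (m' + a)) :=
            mul_le_mul_of_nonneg_left (hfu K _) (pow_nonneg hθ0 a)
        _ ≤ θ ^ a * (u K (m' + a) * X) :=
            mul_le_mul_of_nonneg_left (mul_le_mul_of_nonneg_left hd (hu0 K _)) (pow_nonneg hθ0 a)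
        _ = X * (θ ^ a * u K (m' + a)) := by ring
    have hsecond : 0 ≤ γbar * (θ ^ N / (1 - θ)) := by positivity
    linarith

/-- **THE OUTER SUM OF THE `u`-WEIGHTS IS AT MOST `U∕(1−θ)`**: `Σ_{m′ ≤ m} Σ_{a < N, a ≤ K−m′} θ^a u K (m′+a) ≤ U∕(1−θ)`
when `Σ_{j ≤ K} u K j ≤ U`, `u ≥ 0`, `m ≤ K` (each scale `j = m′ + a ≤ K` is counted with total weight
`Σ_a θ^a ≤ 1∕(1−θ)`). [folklore] -/
theorem outer_weights_le (hθ0 : 0 ≤ θ) (hθ1 : θ < 1) {K m N : ℕ} (hmK : m ≤ K) (hu0 : ∀ K j, 0 ≤ u K j)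
    (hU : ∀ K, ∑ j ∈ range (K + 1), u K j ≤ U) :
    ∑ m' ∈ range (m + 1), ∑ a ∈ range (min N (K - m' + 1)), θ ^ a * u K (m' + a) ≤ U / (1 - θ) := by
  have h1θ : 0 < 1 - θ := by linarith
  have hU0 : 0 ≤ U := le_trans (sum_nonneg fun j _ => hu0 0 j) (hU 0)
  -- bound each inner sum by the sum over ALL `a ≤ K − m′`, then exchange: Σ_{m′} Σ_{a} θ^a u(m′+a) = Σ_a θ^a Σ_{m′} u(m′+a)
  calc ∑ m' ∈ range (m + 1), ∑ a ∈ range (min N (K - m' + 1)), θ ^ a * u K (m' + a)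
      ≤ ∑ m' ∈ range (m + 1), ∑ a ∈ range (K + 1), θ ^ a * (if m' + a ≤ K then u K (m' + a) else 0) := by
        refine sum_le_sum fun m' hm' => ?_
        have hm'' : m' ≤ m := Nat.lt_succ_iff.1 (mem_range.1 hm')
        have hsub : range (min N (K - m' + 1)) ⊆ range (K + 1) := range_mono (by omega)
        refine le_trans (le_of_eq ?_) (sum_le_sum_of_subset_of_nonneg hsub fun a _ _ => ?_)
        · refine sum_congr rfl fun a ha => ?_
          have ha' : a < min N (K - m' + 1) := mem_range.1 ha
          rw [if_pos (by omega)]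
        · split_ifs
          · exact mul_nonneg (pow_nonneg hθ0 a) (hu0 K _)
          · simp
    _ = ∑ a ∈ range (K + 1), θ ^ a * ∑ m' ∈ range (m + 1), (if m' + a ≤ K then u K (m' + a) else 0) := by
        rw [sum_comm]
        exact sum_congr rfl fun a _ => by rw [mul_sum]
    _ ≤ ∑ a ∈ range (K + 1), θ ^ a * U := by
        refine sum_le_sum fun a _ => mul_le_mul_of_nonneg_left ?_ (pow_nonneg hθ0 a)
        -- Σ_{m′ ≤ m, m′+a ≤ K} u K (m′+a) ≤ Σ_{j ≤ K} u K j  (reindex j = m′ + a, injective)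
        calc ∑ m' ∈ range (m + 1), (if m' + a ≤ K then u K (m' + a) else 0)
            = ∑ m' ∈ (range (m + 1)).filter (fun m' => m' + a ≤ K), u K (m' + a) := by
              rw [sum_filter]
          _ = ∑ j ∈ ((range (m + 1)).filter (fun m' => m' + a ≤ K)).image (fun m' => m' + a), u K j := by
              rw [sum_image]
              intro x _ y _ hxy
              exact Nat.add_right_cancel hxy
          _ ≤ ∑ j ∈ range (K + 1), u K j := by
              refine sum_le_sum_of_subset_of_nonneg ?_ fun j _ _ => hu0 K j
              intro j hj
              rw [mem_image] at hj
              obtain ⟨m', hm', rfl⟩ := hj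
              rw [mem_filter] at hm'
              exact mem_range.2 (Nat.lt_succ_of_le hm'.2)
          _ ≤ U := hU K
    _ = (∑ a ∈ range (K + 1), θ ^ a) * U := by rw [sum_mul]
    _ ≤ (1 - θ)⁻¹ * U := by
        refine mul_le_mul_of_nonneg_right ?_ hU0
        rw [← tsum_geometric_of_lt_one hθ0 hθ1]
        exact (summable_geometric_of_lt_one hθ0 hθ1).sum_le_tsum _ fun i _ => pow_nonneg hθ0 i
    _ = U / (1 - θ) := by rw [div_eq_inv_mul]

/-! ## §2 The screw, with the box tail and the scale-wise a-priori bound -/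

/-- **ONE TURN OF THE SCREW (box form).**  If beyond `K₀` the discrepancies at the scales `≤ M + N` are `≤ X` (`X ≥ 0`),
then beyond `max K₀ (M + N)` at the scales `m ≤ M`:  `d K m ≤ s K m + q·X + C·(M+1)·γ̄·θ^N∕(1−θ)`. [folklore] -/
theorem marginalBox_step (hθ0 : 0 ≤ θ) (hθ1 : θ < 1) (hC : 0 ≤ C) (hγ : 0 ≤ γbar)
    (hu0 : ∀ K j, 0 ≤ u K j) (hU : ∀ K, ∑ j ∈ range (K + 1), u K j ≤ U) (hq : C * (U / (1 - θ)) ≤ q)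
    (hfγ : ∀ K j, f K j ≤ γbar) (hfu : ∀ K j, f K j ≤ u K j * d K j)
    (H : ∀ K m, m ≤ K → d K m ≤ s K m +
      C * ∑ m' ∈ range (m + 1), ∑ a ∈ range (K - m' + 1), θ ^ a * f K (m' + a))
    {M N K₀ : ℕ} {X : ℝ} (hX0 : 0 ≤ X) (hX : ∀ K, K₀ ≤ K → ∀ j, j ≤ M + N → d K j ≤ X) :
    ∀ K, max K₀ (M + N) ≤ K → ∀ m, m ≤ M →
      d K m ≤ s K m + q * X + C * ((M + 1 : ℕ) : ℝ) * (γbar * (θ ^ N / (1 - θ))) := by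
  intro K hK m hm
  have hK₀ : K₀ ≤ K := le_trans (le_max_left _ _) hK
  have hMK : M + N ≤ K := le_trans (le_max_right _ _) hK
  have hmK : m ≤ K := by omega
  have h1θ : 0 < 1 - θ := by linarith
  have hH := H K m hmK
  have hinner : ∀ m' ∈ range (m + 1), ∑ a ∈ range (K - m' + 1), θ ^ a * f K (m' + a)
      ≤ X * ∑ a ∈ range (min N (K - m' + 1)), θ ^ a * u K (m' + a) + γbar * (θ ^ N / (1 - θ)) := by
    intro m' hm'
    have hm'M : m' ≤ M := by have := mem_range.1 hm'; omega
    exact inner_le_split hθ0 hθ1 hγ hm'M hfγ hfu hu0 (hX K hK₀)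
  have hsum : ∑ m' ∈ range (m + 1), ∑ a ∈ range (K - m' + 1), θ ^ a * f K (m' + a)
      ≤ X * (U / (1 - θ)) + ((m + 1 : ℕ) : ℝ) * (γbar * (θ ^ N / (1 - θ))) := by
    calc _ ≤ ∑ m' ∈ range (m + 1),
          (X * ∑ a ∈ range (min N (K - m' + 1)), θ ^ a * u K (m' + a) + γbar * (θ ^ N / (1 - θ))) :=
          sum_le_sum hinner
      _ = X * ∑ m' ∈ range (m + 1), ∑ a ∈ range (min N (K - m' + 1)), θ ^ a * u K (m' + a)
            + ((m + 1 : ℕ) : ℝ) * (γbar * (θ ^ N / (1 - θ))) := by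
          rw [sum_add_distrib, mul_sum, sum_const, card_range, nsmul_eq_mul]
      _ ≤ X * (U / (1 - θ)) + ((m + 1 : ℕ) : ℝ) * (γbar * (θ ^ N / (1 - θ))) := by
          have := outer_weights_le hθ0 hθ1 (N := N) hmK hu0 hU
          have := mul_le_mul_of_nonneg_left this hX0
          linarith
  have hmM : ((m + 1 : ℕ) : ℝ) ≤ ((M + 1 : ℕ) : ℝ) := by exact_mod_cast Nat.succ_le_succ hm
  have hT0 : 0 ≤ γbar * (θ ^ N / (1 - θ)) := by positivity
  have h3 : C * (X * (U / (1 - θ))) ≤ q * X := by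
    have := mul_le_mul_of_nonneg_right hq hX0
    linarith [this]
  have h4 : C * (((m + 1 : ℕ) : ℝ) * (γbar * (θ ^ N / (1 - θ))))
      ≤ C * ((M + 1 : ℕ) : ℝ) * (γbar * (θ ^ N / (1 - θ))) := by
    rw [mul_assoc]
    exact mul_le_mul_of_nonneg_left (mul_le_mul_of_nonneg_right hmM hT0) hC
  have h5 := mul_le_mul_of_nonneg_left hsum hC
  rw [mul_add] at h5
  linarith

/-- **AFTER `p` TURNS (box form).**  With the scale-wise affine a-priori bound `d K m ≤ B₀ + B₁·m` (`B₀, B₁ ≥ 0`): for all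
`N p M` and `ε > 0` there is `K₀` beyond which, for `m ≤ M`,
`d K m ≤ q^p·(B₀ + B₁·(M + p·N)) + (Σ_{i<p} q^i·(M + i·N + 1))·C·γ̄·θ^N∕(1−θ) + ε`. [folklore] -/
theorem marginalBox_iterate (hθ0 : 0 ≤ θ) (hθ1 : θ < 1) (hC : 0 ≤ C) (hγ : 0 ≤ γbar)
    (hu0 : ∀ K j, 0 ≤ u K j) (hU : ∀ K, ∑ j ∈ range (K + 1), u K j ≤ U) (hq : C * (U / (1 - θ)) ≤ q)
    (hq0 : 0 ≤ q) (hq1 : q < 1)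
    (hfγ : ∀ K j, f K j ≤ γbar) (hfu : ∀ K j, f K j ≤ u K j * d K j)
    (hs : ∀ m, Tendsto (fun K => s K m) atTop (𝓝 0))
    (hB₀ : 0 ≤ B₀) (hB₁ : 0 ≤ B₁) (hB : ∀ K m, m ≤ K → d K m ≤ B₀ + B₁ * m)
    (H : ∀ K m, m ≤ K → d K m ≤ s K m +
      C * ∑ m' ∈ range (m + 1), ∑ a ∈ range (K - m' + 1), θ ^ a * f K (m' + a))
    (N p : ℕ) : ∀ (M : ℕ) (ε : ℝ), 0 < ε → ∃ K₀ : ℕ, ∀ K, K₀ ≤ K → ∀ m, m ≤ M →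
      d K m ≤ q ^ p * (B₀ + B₁ * ((M + p * N : ℕ) : ℝ))
        + (∑ i ∈ range p, q ^ i * (((M + i * N + 1 : ℕ) : ℝ))) * (C * (γbar * (θ ^ N / (1 - θ)))) + ε := by
  have h1θ : 0 < 1 - θ := by linarith
  set T := C * (γbar * (θ ^ N / (1 - θ))) with hT
  have hT0 : 0 ≤ T := by positivity
  induction p with
  | zero =>
      intro M ε hε
      refine ⟨M, fun K hK m hm => ?_⟩
      have hb := hB K m (by omega)
      have e : ((M + 0 * N : ℕ) : ℝ) = (M : ℝ) := by push_cast; ring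
      have hmono : B₀ + B₁ * (m : ℝ) ≤ B₀ + B₁ * (M : ℝ) := by
        have : (m : ℝ) ≤ (M : ℝ) := by exact_mod_cast hm
        nlinarith
      rw [e, pow_zero, one_mul, sum_range_zero, zero_mul, add_zero]
      linarith
  | succ p ih =>
      intro M ε hε
      obtain ⟨K₀, hK₀⟩ := ih (M + N) (ε / 2) (by linarith)
      obtain ⟨K₁, hK₁⟩ := NE7PairwiseMarginal.sources_eventually_small hs M (half_pos hε)
      set X := q ^ p * (B₀ + B₁ * ((M + N + p * N : ℕ) : ℝ))
        + (∑ i ∈ range p, q ^ i * (((M + N + i * N + 1 : ℕ) : ℝ))) * T + ε / 2 with hX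
      have hX0 : 0 ≤ X := by
        have : 0 ≤ ∑ i ∈ range p, q ^ i * (((M + N + i * N + 1 : ℕ) : ℝ)) :=
          sum_nonneg fun i _ => by positivity
        positivity
      have hstep := marginalBox_step hθ0 hθ1 hC hγ hu0 hU hq hfγ hfu H (M := M) (N := N) (K₀ := K₀) hX0 hK₀
      refine ⟨max (max K₀ (M + N)) K₁, fun K hK m hm => ?_⟩
      have hKa : max K₀ (M + N) ≤ K := le_trans (le_max_left _ _) hK
      have hKb : K₁ ≤ K := le_trans (le_max_right _ _) hK
      have h1 := hstep K hKa m hm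
      have h2 := hK₁ K hKb m hm
      -- arithmetic: s + qX + (M+1)T ≤ ε/2 + q^{p+1}B(M+(p+1)N) + [q Σ_{i<p} q^i (M+N+iN+1) + (M+1)] T + qε/2
      have e1 : ((M + N + p * N : ℕ) : ℝ) = ((M + (p + 1) * N : ℕ) : ℝ) := by
        push_cast; ring
      have e2 : q * ((∑ i ∈ range p, q ^ i * (((M + N + i * N + 1 : ℕ) : ℝ))) * T)
          + C * ((M + 1 : ℕ) : ℝ) * (γbar * (θ ^ N / (1 - θ)))
          = (∑ i ∈ range (p + 1), q ^ i * (((M + i * N + 1 : ℕ) : ℝ))) * T := by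
        rw [hT, sum_range_succ', pow_zero, one_mul, Nat.zero_mul, Nat.add_zero]
        have : ∑ i ∈ range p, q ^ (i + 1) * (((M + (i + 1) * N + 1 : ℕ) : ℝ))
            = q * ∑ i ∈ range p, q ^ i * (((M + N + i * N + 1 : ℕ) : ℝ)) := by
          rw [mul_sum]
          refine sum_congr rfl fun i _ => ?_
          have : ((M + (i + 1) * N + 1 : ℕ) : ℝ) = ((M + N + i * N + 1 : ℕ) : ℝ) := by push_cast; ring
          rw [this, pow_succ]
          ring
        rw [this]
        ring
      have hqε : q * (ε / 2) ≤ ε / 2 := by nlinarith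
      have hqX : q * X = q * (q ^ p * (B₀ + B₁ * ((M + N + p * N : ℕ) : ℝ)))
          + q * ((∑ i ∈ range p, q ^ i * (((M + N + i * N + 1 : ℕ) : ℝ))) * T) + q * (ε / 2) := by
        rw [hX]; ring
      have e3 : q * (q ^ p * (B₀ + B₁ * ((M + N + p * N : ℕ) : ℝ)))
          = q ^ (p + 1) * (B₀ + B₁ * ((M + (p + 1) * N : ℕ) : ℝ)) := by
        rw [e1, pow_succ]; ring
      linarith [h1, h2, e2, e3, hqX, hqε]

/-- **THE DISCREPANCY TENDS TO ZERO AT EVERY FIXED SCALE (box form, no uniform source bound).**  Under (H′) with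
`0 ≤ f ≤ γ̄`, `f ≤ u·d`, `u ≥ 0` with partial sums `≤ U`, `0 ≤ θ < 1`, the window `C·U∕(1−θ) ≤ q < 1`, sources `s K m`
null at every fixed `m` (no bound assumed), and the scale-wise affine a-priori bound `d K m ≤ B₀ + B₁·m`:
`d K m → 0` as `K → ∞`, for every `m`. [folklore] -/
theorem marginalBox_tendsto_zero (hθ0 : 0 ≤ θ) (hθ1 : θ < 1) (hC : 0 ≤ C) (hγ : 0 ≤ γbar)
    (hu0 : ∀ K j, 0 ≤ u K j) (hU : ∀ K, ∑ j ∈ range (K + 1), u K j ≤ U) (hq : C * (U / (1 - θ)) ≤ q)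
    (hq0 : 0 ≤ q) (hq1 : q < 1)
    (hfγ : ∀ K j, f K j ≤ γbar) (hfu : ∀ K j, f K j ≤ u K j * d K j)
    (hs : ∀ m, Tendsto (fun K => s K m) atTop (𝓝 0)) (hd0 : ∀ K m, 0 ≤ d K m)
    (hB₀ : 0 ≤ B₀) (hB₁ : 0 ≤ B₁) (hB : ∀ K m, m ≤ K → d K m ≤ B₀ + B₁ * m)
    (H : ∀ K m, m ≤ K → d K m ≤ s K m +
      C * ∑ m' ∈ range (m + 1), ∑ a ∈ range (K - m' + 1), θ ^ a * f K (m' + a)) :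
    ∀ m, Tendsto (fun K => d K m) atTop (𝓝 0) := by
  intro m
  have h1θ : 0 < 1 - θ := by linarith
  rw [Metric.tendsto_atTop]
  intro ε hε
  -- (1) the tail coefficient: Σ_{i<p} q^i (m + iN + 1) ≤ (m+1)/(1−q) + N·S₂ with S₂ := Σ' i, q^i·i... we use the cruder
  --     bound Σ_{i<p} q^i (m + iN + 1) ≤ (m + 1 + N) · Σ_{i<p} q^i (i+1) ≤ (m+1+N)·A with A := ∑' i, q^i (i+1).
  have hA : Summable fun i : ℕ => q ^ i * ((i : ℝ) + 1) := by
    have h1 : Summable fun i : ℕ => ((i : ℝ) + 1) * q ^ i := by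
      have := summable_pow_mul_geometric_of_norm_lt_one (R := ℝ) 1 (by rwa [Real.norm_eq_abs, abs_of_nonneg hq0])
      -- `i^1 q^i` summable; and `q^i` summable
      have h2 : Summable fun i : ℕ => (i : ℝ) ^ 1 * q ^ i := this
      simpa [pow_one, add_mul] using h2.add (summable_geometric_of_lt_one hq0 hq1)
    exact h1.congr fun i => by ring
  set A := ∑' i : ℕ, q ^ i * ((i : ℝ) + 1) with hAdef
  have hA0 : 0 ≤ A := tsum_nonneg fun i => by positivity
  have hcoef : ∀ p N : ℕ, ∑ i ∈ range p, q ^ i * (((m + i * N + 1 : ℕ) : ℝ)) ≤ ((m + 1 + N : ℕ) : ℝ) * A := by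
    intro p N
    calc ∑ i ∈ range p, q ^ i * (((m + i * N + 1 : ℕ) : ℝ))
        ≤ ∑ i ∈ range p, ((m + 1 + N : ℕ) : ℝ) * (q ^ i * ((i : ℝ) + 1)) := by
          refine sum_le_sum fun i _ => ?_
          have : (((m + i * N + 1 : ℕ) : ℝ)) ≤ ((m + 1 + N : ℕ) : ℝ) * ((i : ℝ) + 1) := by
            push_cast
            nlinarith [Nat.cast_nonneg (α := ℝ) i, Nat.cast_nonneg (α := ℝ) N, Nat.cast_nonneg (α := ℝ) m]
          calc q ^ i * (((m + i * N + 1 : ℕ) : ℝ)) ≤ q ^ i * (((m + 1 + N : ℕ) : ℝ) * ((i : ℝ) + 1)) :=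
                mul_le_mul_of_nonneg_left this (pow_nonneg hq0 i)
            _ = ((m + 1 + N : ℕ) : ℝ) * (q ^ i * ((i : ℝ) + 1)) := by ring
      _ = ((m + 1 + N : ℕ) : ℝ) * ∑ i ∈ range p, q ^ i * ((i : ℝ) + 1) := by rw [mul_sum]
      _ ≤ ((m + 1 + N : ℕ) : ℝ) * A :=
          mul_le_mul_of_nonneg_left (hA.sum_le_tsum _ fun i _ => by positivity) (by positivity)
  -- (2) choose N: ((m+1+N)·A)·C·γ̄·θ^N/(1−θ) → 0 as N → ∞
  have hNlim : Tendsto (fun N : ℕ => ((m + 1 + N : ℕ) : ℝ) * A * (C * (γbar * (θ ^ N / (1 - θ))))) atTop (𝓝 0) := by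
    -- (m+1+N) θ^N → 0
    have hlin : Tendsto (fun N : ℕ => ((m + 1 + N : ℕ) : ℝ) * θ ^ N) atTop (𝓝 0) := by
      have h1 : Tendsto (fun N : ℕ => (N : ℝ) ^ 1 * θ ^ N) atTop (𝓝 0) :=
        tendsto_pow_const_mul_const_pow_of_abs_lt_one 1 (by rwa [abs_of_nonneg hθ0])
      have h2 : Tendsto (fun N : ℕ => θ ^ N) atTop (𝓝 0) := tendsto_pow_atTop_nhds_zero_of_lt_one hθ0 hθ1
      have h3 := (h1.add (h2.const_mul ((m : ℝ) + 1)))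
      simp only [pow_one, add_zero, mul_zero] at h3
      refine h3.congr fun N => ?_
      push_cast; ring
    have := hlin.mul_const (A * (C * (γbar / (1 - θ))))
    rw [zero_mul] at this
    refine this.congr fun N => ?_
    ring
  obtain ⟨N, hN⟩ := (Metric.tendsto_atTop.1 hNlim) (ε / 4) (by linarith)
  have hN' := hN N le_rfl
  rw [Real.dist_eq, sub_zero, abs_of_nonneg (by positivity)] at hN'
  -- (3) choose p: q^p (B₀ + B₁ (m + pN)) → 0
  have hplim : Tendsto (fun p : ℕ => q ^ p * (B₀ + B₁ * ((m + p * N : ℕ) : ℝ))) atTop (𝓝 0) := by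
    have h1 : Tendsto (fun p : ℕ => (p : ℝ) ^ 1 * q ^ p) atTop (𝓝 0) :=
      tendsto_pow_const_mul_const_pow_of_abs_lt_one 1 (by rwa [abs_of_nonneg hq0])
    have h2 : Tendsto (fun p : ℕ => q ^ p) atTop (𝓝 0) := tendsto_pow_atTop_nhds_zero_of_lt_one hq0 hq1
    have h3 := (h2.const_mul (B₀ + B₁ * (m : ℝ))).add (h1.const_mul (B₁ * (N : ℝ)))
    simp only [pow_one, mul_zero, add_zero] at h3
    refine h3.congr fun p => ?_
    push_cast; ring
  obtain ⟨p, hp⟩ := (Metric.tendsto_atTop.1 hplim) (ε / 4) (by linarith)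
  have hp' := hp p le_rfl
  rw [Real.dist_eq, sub_zero, abs_of_nonneg (by positivity)] at hp'
  -- (4) K₀ from the iterate with ε/4
  obtain ⟨K₀, hK₀⟩ := marginalBox_iterate hθ0 hθ1 hC hγ hu0 hU hq hq0 hq1 hfγ hfu hs hB₀ hB₁ hB H N p m
    (ε / 4) (by linarith)
  refine ⟨K₀, fun K hK => ?_⟩
  have h := hK₀ K hK m le_rfl
  rw [Real.dist_eq, sub_zero, abs_of_nonneg (hd0 K m)]
  have htail : (∑ i ∈ range p, q ^ i * (((m + i * N + 1 : ℕ) : ℝ))) * (C * (γbar * (θ ^ N / (1 - θ))))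
      ≤ ((m + 1 + N : ℕ) : ℝ) * A * (C * (γbar * (θ ^ N / (1 - θ)))) :=
    mul_le_mul_of_nonneg_right (hcoef p N) (by positivity)
  linarith

end Summit.QuantumFields.BalabanUV.T4Continuum.NE7PairwiseMarginalBox
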